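import Mathlib
import Literature.NumberTheory.Sieve.RoughOmegaCells
import Summits.Parity.GeneralizedHardyLittlewood.Theorems.ParityLeakOneFifthPlainSplitTwistedCellSieve
import HarnessLib

/-!
# Route ParityLeakOneFifth, crux `ParityLeakSieve` (stmt-Parity-18381), skeleton `birth`:
# the corner count of stub S2, combinatorial part

The census term of the zero-parity-defect inequality (file `…ParityLeakSieveCensus.lean`) on the
`Ω = 4` type is `#{d ∣ m : Ω(d) = 2, D < d, d² < m}`.  Summed over the `z`-rough `n ∈ (x, 2x]` with
`m = n + 2` `y`-rough of type `Ω = 4`, and after exchanging the order of summation, it is at most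
`Σ_{d} #{n ∈ (x,2x] : n z-rough, d ∣ n+2, P⁻((n+2)/d) ≥ ⌈y⌉, Ω((n+2)/d) = 2}` over the semiprime
`y`-rough `d` with `D < d`, `d² ≤ 2x+2` (`corner_exchange_le`) — the shape consumed by the `P`-twisted
cell sieve `twistedCellP_sieve_le`.
-/

namespace Summit.Parity.GeneralizedHardyLittlewood.Theorems.ParityLeakOneFifth

open Finset
open scoped ArithmeticFunction.Omega
open Literature.NumberTheory.Sieve

/-- For `m` with `y ≤ minFac m` (real `y`), every prime factor of a divisor `d ∣ m` is `≥ y`. -/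
theorem primeFactors_ge_of_dvd_of_minFac {m d : ℕ} {y : ℝ} (hy : y ≤ (m.minFac : ℝ))
    (hd : d ∣ m) : ∀ p ∈ d.primeFactors, y ≤ (p : ℝ) := by
  intro p hp
  obtain ⟨hpr, hpd, -⟩ := Nat.mem_primeFactors.1 hp
  have h := Nat.minFac_le_of_dvd hpr.two_le (hpd.trans hd)
  exact hy.trans (by exact_mod_cast h)

/-- **Exchange of summation for the corner count.** With `F₄ = {n ∈ (x,2x] : n z-rough,
y ≤ P⁻(n+2), Ω(n+2) = 4}` and `𝒟 = {d < 2x+3 : Ω d = 2, d y-rough, D < d, d² ≤ 2x+2}`: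
`Σ_{n ∈ F₄} #{d ∣ n+2 : Ω d = 2, D < d, d² < n+2}
 ≤ Σ_{d ∈ 𝒟} #{n ∈ (x,2x] : n z-rough, d ∣ n+2, ⌈y⌉ ≤ P⁻((n+2)/d), Ω((n+2)/d) = 2}`. -/
theorem corner_exchange_le (x : ℕ) (z y D : ℝ) :
    ∑ n ∈ (Finset.Ioc x (2 * x)).filter (fun n : ℕ => (∀ p ∈ n.primeFactors, z ≤ (p : ℝ)) ∧
        y ≤ ((n + 2).minFac : ℝ) ∧ ArithmeticFunction.cardFactors (n + 2) = 4),
      (#((Nat.divisors (n + 2)).filter (fun d : ℕ => ArithmeticFunction.cardFactors d = 2 ∧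
          D < (d : ℝ) ∧ d * d < n + 2)) : ℝ) ≤
    ∑ d ∈ (Finset.range (2 * x + 3)).filter (fun d : ℕ => ArithmeticFunction.cardFactors d = 2 ∧
        (∀ p ∈ d.primeFactors, y ≤ (p : ℝ)) ∧ D < (d : ℝ) ∧ d * d ≤ 2 * x + 2),
      (#((Finset.Ioc x (2 * x)).filter (fun m : ℕ => (∀ p ∈ m.primeFactors, z ≤ (p : ℝ)) ∧
          d ∣ m + 2 ∧ ⌈y⌉₊ ≤ ((m + 2) / d).minFac ∧
          ArithmeticFunction.cardFactors ((m + 2) / d) = 2)) : ℝ) := by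
  set F₄ := (Finset.Ioc x (2 * x)).filter (fun n : ℕ => (∀ p ∈ n.primeFactors, z ≤ (p : ℝ)) ∧
      y ≤ ((n + 2).minFac : ℝ) ∧ ArithmeticFunction.cardFactors (n + 2) = 4) with hF₄
  set 𝒟 := (Finset.range (2 * x + 3)).filter (fun d : ℕ => ArithmeticFunction.cardFactors d = 2 ∧
      (∀ p ∈ d.primeFactors, y ≤ (p : ℝ)) ∧ D < (d : ℝ) ∧ d * d ≤ 2 * x + 2) with h𝒟
  -- Step A: the divisor filter is a filter of `𝒟`
  have hA : ∀ n ∈ F₄, (Nat.divisors (n + 2)).filter (fun d : ℕ => ArithmeticFunction.cardFactors d = 2 ∧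
      D < (d : ℝ) ∧ d * d < n + 2) = 𝒟.filter (fun d : ℕ => d ∣ n + 2 ∧ d * d < n + 2) := by
    intro n hn
    rw [hF₄, Finset.mem_filter, Finset.mem_Ioc] at hn
    obtain ⟨⟨hn1, hn2⟩, -, hmin, -⟩ := hn
    ext d
    simp only [Finset.mem_filter, Nat.mem_divisors, h𝒟, Finset.mem_range]
    constructor
    · rintro ⟨⟨hdvd, -⟩, hΩ, hDd, hdd⟩
      have hd1 : 1 ≤ d := Nat.pos_of_ne_zero (by rintro rfl; simp at hΩ)
      refine ⟨⟨?_, hΩ, primeFactors_ge_of_dvd_of_minFac hmin hdvd, hDd, by omega⟩, hdvd, hdd⟩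
      nlinarith
    · rintro ⟨⟨-, hΩ, -, hDd, -⟩, hdvd, hdd⟩
      exact ⟨⟨hdvd, by omega⟩, hΩ, hDd, hdd⟩
  rw [Finset.sum_congr rfl fun n hn => by rw [hA n hn]]
  -- Step B/C: cardinalities as indicator sums, exchange
  have hB : ∀ n ∈ F₄, (#(𝒟.filter (fun d : ℕ => d ∣ n + 2 ∧ d * d < n + 2)) : ℝ) =
      ∑ d ∈ 𝒟, if d ∣ n + 2 ∧ d * d < n + 2 then (1 : ℝ) else 0 := by
    intro n _
    rw [Finset.sum_ite, Finset.sum_const_zero, add_zero, Finset.sum_const, nsmul_eq_mul, mul_one]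
  rw [Finset.sum_congr rfl hB, Finset.sum_comm]
  refine Finset.sum_le_sum fun d hd => ?_
  rw [← Finset.sum_filter, Finset.sum_const, nsmul_eq_mul, mul_one]
  -- Step D: for fixed `d`, the `n` counted lie in the twisted cell
  have hd' := hd
  rw [h𝒟, Finset.mem_filter] at hd'
  obtain ⟨-, hΩd, -, -, -⟩ := hd'
  have hd0 : d ≠ 0 := by rintro rfl; simp at hΩd
  norm_cast
  refine Finset.card_le_card fun n hn => ?_
  rw [Finset.mem_filter, hF₄, Finset.mem_filter] at hn
  obtain ⟨⟨hIoc, hrough, hmin, hΩ4⟩, hdvd, -⟩ := hn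
  rw [Finset.mem_filter]
  have hm0 : n + 2 ≠ 0 := by omega
  obtain ⟨k, hk⟩ := hdvd
  have hk0 : k ≠ 0 := by rintro rfl; rw [mul_zero] at hk; exact hm0 hk
  have hkdef : (n + 2) / d = k := by rw [hk, Nat.mul_div_cancel_left k (Nat.pos_of_ne_zero hd0)]
  have hΩk : ArithmeticFunction.cardFactors k = 2 := by
    have := ArithmeticFunction.cardFactors_mul hd0 hk0
    rw [← hk, hΩ4, hΩd] at this; omega
  have hk2 : 2 ≤ k := by
    by_contra h
    rw [not_le] at h
    interval_cases k <;> simp [ArithmeticFunction.cardFactors_one] at hΩk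
  refine ⟨hIoc, hrough, ⟨k, hk⟩, ?_, by rw [hkdef]; exact hΩk⟩
  rw [hkdef]
  refine (forall_primeFactors_le_iff hk2).1 fun p hp => ?_
  have hkdvd : k ∣ n + 2 := ⟨d, by rw [hk, mul_comm]⟩
  exact Nat.ceil_le.2 (primeFactors_ge_of_dvd_of_minFac hmin hkdvd p hp)

end Summit.Parity.GeneralizedHardyLittlewood.Theorems.ParityLeakOneFifth
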